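import Literature.NumberTheory.Automorphic.ArchInnerFormChartOrbLocal         -- ★ G2 (LH3-p02): `chartOrbGLoc` (the one-place box-normalised orbital functional), `chartTorusGLoc`, `gprimeBlockAt`
import Literature.NumberTheory.Rogawski1990.ArchBouazizClassMapG              -- ★ (7) F0 (LH3-p04 (g7)): `bzClassMapG`, `chartEigG`, `esymm3`, `cubicDisc` (the one-place class currency)
import HarnessLib

/-!
# The ONE-PLACE EULER–POINCARÉ GENERATOR HEAD `EPGeneratorAt` — the common target shape of the regular (7), wall (8) and scalar-corner (10) one-place generators of N8-INNER ROAD B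
# (Rogawski 1990 §8.2; Shelstad 1979 §4; Bouaziz 1994 §6.2)

Topic `NumberTheory/Rogawski1990`; namespace `Literature.NumberTheory.Rogawski1990`.  ONE `Prop`-VALUED DEFINITION (`EPGeneratorAt`, a closed formula over ★ tokens: no instance, no notation,
no placeholder) + its unfolding and the ε-shrinking lemma; no axiom, no named fact, no `sorry`.  Cell `pub/hodgecm-mathlib`, crux H413 (`stmt-HodgeConjecture-24833`), F0∕P3c road «N8-INNER»
ROAD B «EULER–POINCARÉ ROAD» (LH2-plan (g1) 16:08:52Z ∕ 16:17:17Z GO), brick (12′) «EP ASSEMBLY» FILE E1 (deal 16:12:42Z → LH7-p01 (g7); CENSUS `F0/P3c/LH7/LH7-p01/g7/ep/CENSUS-N8-brick12EP.v1.LH7p01g7.md`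
4b6e6521d5d67659 §2; dealer «def OK» 16:19:50Z; LHref-N BOX LH2 #23 «def OK from the referee side», remarks (i)–(iv)).  Count-neutral.

THE HEAD.  One complex place `w`, a diagonal frame `α` (on the road: `β₀ = (½, 1, −½)`, `U(β₀)_w ≅ U(2,1)`), a Haar measure `νw` on `U(α)_w = archLocal L 3 (diagonal α) w`, an ELLIPTIC base class
`b ∈ ℂ³` (the `esymm3` of a unit triple).  `EPGeneratorAt L α w νw b` says: there are `ε > 0`, a ONE-PLACE TEST FUNCTION `f : U(α)_w → ℂ` (the (KN) class: restriction of an ambient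
`ContDiff ℝ ∞` function of the matrix, with compact support) and `h : ℂ³ → ℂ` smooth with `h b ≠ 0`, such that for every chart label `S′` and every coordinate `c` REGULAR AT `w` (the `w`-clause
of ★ `mem_regG_iff`) whose `w`-class ★ `bzClassMapG S′ c w` is `ε`-close to `b`:
* if `w ∈ S′` (the chart is SPLIT at `w`): the one-place reading VANISHES, `chartOrbGLoc L α w S′ νw f (c w) = 0` — «cuspidal at `w`», the (T2) branch of (14.2.1) for free;
* if `w ∉ S′` (the chart is COMPACT at `w`): the PLAIN STABLE SLOT SUM of the one-place readings is the class function, `Σ_{σ ∈ S₃} chartOrbGLoc L α w S′ νw f (c w ∘ σ) = h (bzClassMapG S′ c w)`.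
This is the plain, untwisted, unnormalised currency that ★ READ-G (`partnerWeight · Σ_ρ chartOrbG … (slotPerm ρ c)`), ★ `stableSumG_eq_archRG_mul_sum` and the place factorisation ★ FILE P
`sum_partnerPerms_mul_eq_sum_mul_sum` read; `h` is asked on ALL of `ℂ³` so that `h ∘ bzClassMapG` is smooth in the chart and `h ∘ bzClassG` is a smooth class function (★ F4's multiplier
currency).  SATISFIABLE at the three base-class types (LHref-N BOX #23 (i)): regular-elliptic `b` by (7) F7′ (= ★ F5 p852002 read at one place: the slot sum is `2·SO`, smooth in the class since
`esymm3` is étale where `cubicDisc ≠ 0`); wall `b` by (8) (zero split reading is the content; `SO` even-smooth across the noncompact wall); scalar corner `b = esymm3 (ζ,ζ,ζ)` by (10)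
((KN)+(B)+(C′), `h b ∝ f(ζ·1)`).  NOTHING is asked of `f` away from the class ball (the assembly's class multiplier kills it there, ★ F4 `chartOrbG_classMul`).
* §1 `EPGeneratorAt` (def), `epGeneratorAt_iff`;
* §2 `EPGeneratorAt.of_le` (a smaller `ε` works), **`EPGeneratorAt.exists_forall_ne_zero`** («`h ≠ 0` ON THE BALL», by continuity of `h` — LHref-N (iv), census (v)(c)).
HONEST LABEL: HC_CM is proved only modulo the 7 printed citations (2 remaining: hLiu418 = `stmt-HodgeConjecture-24832`, h413 = `stmt-HodgeConjecture-24833`) until rung 0 closes; count-neutral until the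
junction payer is ★ and ED. 43 re-keys 27456 6 → 5.  This file proves no generator: (7)(8)(10) do.

## References
* [Rogawski1990] J. D. Rogawski, *Automorphic Representations of Unitary Groups in Three Variables*, Ann. of Math. Stud. 123 (1990), §8.2 pp. 118–122 (orbital integrals on the Cartan subgroups of
  `U(2,1)`, place by place), §14.2 (14.2.1) p. 232 (the vanishing branch at non-matching classes).
* [Shelstad1979] D. Shelstad, *Characters and inner forms of a quasi-split group over ℝ*, Compositio Math. 39 (1979), §4 pp. 22–26, Lemma 4.2 (stable orbital integrals as slot sums).
* [Bouaziz1994IntegralesOrbitales] A. Bouaziz, *Intégrales orbitales sur les groupes de Lie réductifs*, Ann. Sci. ÉNS (4) 27 (1994), §6.2 pp. 591–594 (the class-function description near a base class).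
-/

set_option autoImplicit false

noncomputable section

open MeasureTheory MeasureTheory.Measure NumberField NumberField.InfinitePlace Matrix Complex Topology Metric
open Literature.NumberTheory.Automorphic Literature.NumberTheory.Automorphic.UnitaryGroup Literature.NumberTheory.Automorphic.ArchCartan
open scoped MatrixGroups Matrix ContDiff Classical Matrix.Norms.Operator

namespace Literature.NumberTheory.Rogawski1990

section Head

variable (L : Type) [Field L] [NumberField L] [IsCMField L] (α : Fin 3 → L) (w : {w : InfinitePlace L // IsComplex w})
  [MeasurableSpace ↥(archLocal L 3 (Matrix.diagonal α) w)] [BorelSpace ↥(archLocal L 3 (Matrix.diagonal α) w)] (νw : Measure ↥(archLocal L 3 (Matrix.diagonal α) w))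
  [νw.IsHaarMeasure] [νw.IsMulRightInvariant]

/-- **`EPGeneratorAt L α w νw b` — THE ONE-PLACE EP GENERATOR HEAD at the elliptic base class `b ∈ ℂ³` of `U(α)_w`**: `∃ ε > 0`, `∃ f` a one-place test function (restriction of an ambient
`C^∞` function of the matrix, compactly supported), `∃ h : ℂ³ → ℂ` smooth with `h b ≠ 0`, such that at every coordinate `c` regular at `w` with `dist (bzClassMapG S′ c w) b < ε`: on a chart SPLIT at
`w` (`w ∈ S′`) the one-place reading `chartOrbGLoc … f (c w)` VANISHES; on a chart COMPACT at `w` (`w ∉ S′`) the plain stable slot sum `Σ_{σ∈S₃} chartOrbGLoc … f (c w ∘ σ)` EQUALS `h (bzClassMapG S′ c w)`.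
The common target of (7) F7′, (8), (10) of N8-INNER ROAD B. [cite: Rogawski1990, §8.2 p. 122; §14.2 (14.2.1) p. 232] [cite: Shelstad1979, §4 p. 22, Lemma 4.2 p. 23]
[cite: Bouaziz1994IntegralesOrbitales, §6.2 p. 591] -/
def EPGeneratorAt (b : ℂ × ℂ × ℂ) : Prop :=
  ∃ ε : ℝ, 0 < ε ∧ ∃ f : ↥(archLocal L 3 (Matrix.diagonal α) w) → ℂ,
    (∃ fa : Matrix (Fin 3) (Fin 3) ℂ → ℂ, ContDiff ℝ ∞ fa ∧ ∀ g, f g = fa ((g : GL (Fin 3) ℂ) : Matrix (Fin 3) (Fin 3) ℂ)) ∧ HasCompactSupport f ∧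
    ∃ h : ℂ × ℂ × ℂ → ℂ, ContDiff ℝ ∞ h ∧ h b ≠ 0 ∧
      (∀ (S' : Finset {w : InfinitePlace L // IsComplex w}) (c : {w : InfinitePlace L // IsComplex w} → Fin 3 → ℝ),
          w ∈ S' → c w 0 ≠ 0 → dist (bzClassMapG S' c w) b < ε → chartOrbGLoc L α w S' νw f (c w) = 0) ∧
      (∀ (S' : Finset {w : InfinitePlace L // IsComplex w}) (c : {w : InfinitePlace L // IsComplex w} → Fin 3 → ℝ),
          w ∉ S' → (Function.Injective fun i : Fin 3 => Circle.exp (c w i)) → dist (bzClassMapG S' c w) b < ε →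
            ∑ σ : Equiv.Perm (Fin 3), chartOrbGLoc L α w S' νw f (c w ∘ σ) = h (bzClassMapG S' c w))

variable {L α w νw}

/-- Unfolding of `EPGeneratorAt`. [cite: Rogawski1990, §8.2 p. 122] -/
theorem epGeneratorAt_iff (b : ℂ × ℂ × ℂ) :
    EPGeneratorAt L α w νw b ↔
      ∃ ε : ℝ, 0 < ε ∧ ∃ f : ↥(archLocal L 3 (Matrix.diagonal α) w) → ℂ,
        (∃ fa : Matrix (Fin 3) (Fin 3) ℂ → ℂ, ContDiff ℝ ∞ fa ∧ ∀ g, f g = fa ((g : GL (Fin 3) ℂ) : Matrix (Fin 3) (Fin 3) ℂ)) ∧ HasCompactSupport f ∧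
        ∃ h : ℂ × ℂ × ℂ → ℂ, ContDiff ℝ ∞ h ∧ h b ≠ 0 ∧
          (∀ (S' : Finset {w : InfinitePlace L // IsComplex w}) (c : {w : InfinitePlace L // IsComplex w} → Fin 3 → ℝ),
              w ∈ S' → c w 0 ≠ 0 → dist (bzClassMapG S' c w) b < ε → chartOrbGLoc L α w S' νw f (c w) = 0) ∧
          (∀ (S' : Finset {w : InfinitePlace L // IsComplex w}) (c : {w : InfinitePlace L // IsComplex w} → Fin 3 → ℝ),
              w ∉ S' → (Function.Injective fun i : Fin 3 => Circle.exp (c w i)) → dist (bzClassMapG S' c w) b < ε →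
                ∑ σ : Equiv.Perm (Fin 3), chartOrbGLoc L α w S' νw f (c w ∘ σ) = h (bzClassMapG S' c w)) :=
  Iff.rfl

/-! ## §2 Shrinking the ball -/

/-- **A smaller ball works**: the head with `ε` gives the head's two clauses for every `ε′ ≤ ε`. [cite: Bouaziz1994IntegralesOrbitales, §6.2 p. 591] -/
theorem EPGeneratorAt.of_le {b : ℂ × ℂ × ℂ} (hb : EPGeneratorAt L α w νw b) {ε' : ℝ} (hε' : 0 < ε') :
    ∃ ε : ℝ, 0 < ε ∧ ε ≤ ε' ∧ ∃ f : ↥(archLocal L 3 (Matrix.diagonal α) w) → ℂ,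
      (∃ fa : Matrix (Fin 3) (Fin 3) ℂ → ℂ, ContDiff ℝ ∞ fa ∧ ∀ g, f g = fa ((g : GL (Fin 3) ℂ) : Matrix (Fin 3) (Fin 3) ℂ)) ∧ HasCompactSupport f ∧
      ∃ h : ℂ × ℂ × ℂ → ℂ, ContDiff ℝ ∞ h ∧ h b ≠ 0 ∧
        (∀ (S' : Finset {w : InfinitePlace L // IsComplex w}) (c : {w : InfinitePlace L // IsComplex w} → Fin 3 → ℝ),
            w ∈ S' → c w 0 ≠ 0 → dist (bzClassMapG S' c w) b < ε → chartOrbGLoc L α w S' νw f (c w) = 0) ∧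
        (∀ (S' : Finset {w : InfinitePlace L // IsComplex w}) (c : {w : InfinitePlace L // IsComplex w} → Fin 3 → ℝ),
            w ∉ S' → (Function.Injective fun i : Fin 3 => Circle.exp (c w i)) → dist (bzClassMapG S' c w) b < ε →
              ∑ σ : Equiv.Perm (Fin 3), chartOrbGLoc L α w S' νw f (c w ∘ σ) = h (bzClassMapG S' c w)) := by
  obtain ⟨ε, hε, f, hf, hfs, h, hh, hhb, hsplit, hcpt⟩ := hb
  refine ⟨min ε ε', lt_min hε hε', min_le_right _ _, f, hf, hfs, h, hh, hhb, fun S' c hw h0 hd => hsplit S' c hw h0 (hd.trans_le (min_le_left _ _)),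
    fun S' c hw hinj hd => hcpt S' c hw hinj (hd.trans_le (min_le_left _ _))⟩

/-- **`h ≠ 0` ON THE BALL** (LHref-N BOX #23 (iv); census (v)(c)): after shrinking `ε` by continuity of `h` at `b`, the class function of the head is non-vanishing on the whole `ε`-ball — the form
the EP assembly divides by (weights `2 ∕ h`). [cite: Bouaziz1994IntegralesOrbitales, §6.2 p. 591] [cite: Shelstad1979, §4 p. 22] -/
theorem EPGeneratorAt.exists_forall_ne_zero {b : ℂ × ℂ × ℂ} (hb : EPGeneratorAt L α w νw b) :
    ∃ ε : ℝ, 0 < ε ∧ ∃ f : ↥(archLocal L 3 (Matrix.diagonal α) w) → ℂ,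
      (∃ fa : Matrix (Fin 3) (Fin 3) ℂ → ℂ, ContDiff ℝ ∞ fa ∧ ∀ g, f g = fa ((g : GL (Fin 3) ℂ) : Matrix (Fin 3) (Fin 3) ℂ)) ∧ HasCompactSupport f ∧
      ∃ h : ℂ × ℂ × ℂ → ℂ, ContDiff ℝ ∞ h ∧ (∀ z, dist z b < ε → h z ≠ 0) ∧
        (∀ (S' : Finset {w : InfinitePlace L // IsComplex w}) (c : {w : InfinitePlace L // IsComplex w} → Fin 3 → ℝ),
            w ∈ S' → c w 0 ≠ 0 → dist (bzClassMapG S' c w) b < ε → chartOrbGLoc L α w S' νw f (c w) = 0) ∧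
        (∀ (S' : Finset {w : InfinitePlace L // IsComplex w}) (c : {w : InfinitePlace L // IsComplex w} → Fin 3 → ℝ),
            w ∉ S' → (Function.Injective fun i : Fin 3 => Circle.exp (c w i)) → dist (bzClassMapG S' c w) b < ε →
              ∑ σ : Equiv.Perm (Fin 3), chartOrbGLoc L α w S' νw f (c w ∘ σ) = h (bzClassMapG S' c w)) := by
  obtain ⟨ε, hε, f, hf, hfs, h, hh, hhb, hsplit, hcpt⟩ := hb
  -- `h ≠ 0` on a neighbourhood of `b`
  have hopen : IsOpen {z : ℂ × ℂ × ℂ | h z ≠ 0} := isOpen_ne_fun hh.continuous continuous_const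
  obtain ⟨δ, hδ, hball⟩ := Metric.isOpen_iff.1 hopen b hhb
  refine ⟨min ε δ, lt_min hε hδ, f, hf, hfs, h, hh, fun z hz => hball (mem_ball.2 (hz.trans_le (min_le_right _ _))),
    fun S' c hw h0 hd => hsplit S' c hw h0 (hd.trans_le (min_le_left _ _)), fun S' c hw hinj hd => hcpt S' c hw hinj (hd.trans_le (min_le_left _ _))⟩

/-- The head's class function is non-zero at the base class (projection). [cite: Bouaziz1994IntegralesOrbitales, §6.2 p. 591] -/
theorem EPGeneratorAt.exists_h_ne_zero {b : ℂ × ℂ × ℂ} (hb : EPGeneratorAt L α w νw b) : ∃ h : ℂ × ℂ × ℂ → ℂ, ContDiff ℝ ∞ h ∧ h b ≠ 0 := by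
  obtain ⟨-, -, -, -, -, h, hh, hhb, -, -⟩ := hb
  exact ⟨h, hh, hhb⟩

end Head

end Literature.NumberTheory.Rogawski1990

end
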